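import Mathlib
import HarnessLib

/-!
# The Subspace Theorem over `ℚ` — IV. Evertse's lemma (B–G Lemma 7.5.29) at the archimedean place

Fourth file towards the `p`-adic Subspace Theorem over `ℚ` (Bombieri–Gubler §7.5 specialised to
`K = ℚ`). **Evertse's lemma** (J.-H. Evertse 1996; B–G Lemma 7.5.29, "given here in a slightly
simplified form paying no attention to numerical constants") replaces Schmidt's use of Mahler's
compound bodies and Davenport's lemma: from a basis `x^{(1)}, …, x^{(n+1)}` with
`|L_k(x^{(j)})| ≤ μ_j` (`μ_1 ≤ ⋯ ≤ μ_{n+1}`) for independent forms `L_0, …, L_n`, it produces a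
unitriangular change `v^{(i)} = x^{(i)} + Σ_{j<i} ξ_{ij} x^{(j)}` with INTEGER `ξ_{ij}` and a
bijection `π` such that `|L_{π(i)}(v^{(j)})| ≤ C min(μ_i, μ_j)` for ALL `i, j`.

For `K = ℚ` only the archimedean place needs the lemma (at a finite place `p` the bound
`min(μ_{p,i}, μ_{p,j}) = 1` of B–G (7.42)–(7.43) just says `v^{(j)} ∈ Λ(Q)`, automatic for integer
`ξ_{ij}`), and there `O_{S,K}`-coefficients may be taken in `ℤ` with `|ξ + γ| ≤ 1/2`
(`ξ = -round γ`); so this file proves the lemma for real forms (rows `f_k` of a real matrix,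
`L_k(y) = f_k · y`) on `ℝ^N`, with integer `ξ_{ij}` and an explicit constant `C = evC N`
depending only on `N`. The proof is B–G's induction on the dimension: a non-trivial relation
`Σ α_k L_k = 0` on `span(x^{(1..n)})`, `π(n+1) :=` an index of a largest `|α_k|` (so
`L_{π(n+1)} = Σ β_k L_k` there with `|β_k| ≤ 1`, (7.38)), the induction hypothesis for the other
forms on `span(x^{(1..n)})` (they stay independent there), and
`v^{(n+1)} = x^{(n+1)} + Σ ξ'_j v^{(j)}` with `ξ'_j = -round(γ_j)`, `γ` solving (7.40).

Main results (namespace `Literature.NumberTheory.DiophantineApproximation.Subspace`):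
* `evC` — the constant; `evertse_aux` — the inductive statement for `m` points and `m` forms;
* `evertse` — **B–G Lemma 7.5.29 for `K = ℚ`, `v = ∞`**: forms = rows of a real `N × N` matrix
  `A` with `det A ≠ 0`, points = any basis `x` of `ℝ^N` with `|(A x_j)_k| ≤ μ_j`.

## References
* [BombieriGubler2006] E. Bombieri, W. Gubler, *Heights in Diophantine Geometry*, CUP 2006,
  7.5.28, Lemma 7.5.29 (pp. 217–219 of the printed book).
* [Evertse1996] J.-H. Evertse, *An improvement of the quantitative Subspace theorem*,
  Compositio Math. 101 (1996), 225–311.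
-/

noncomputable section

open Finset Matrix Module

namespace Literature.NumberTheory.DiophantineApproximation.Subspace

variable {N : ℕ}

/-! ### Linear-algebra preliminaries -/

/-- A linear functional `y ↦ φ · y` vanishing on a set vanishes on its real span. [folklore] -/
theorem dotProduct_eq_zero_of_mem_span {φ : Fin N → ℝ} {s : Set (Fin N → ℝ)}
    (h : ∀ y ∈ s, φ ⬝ᵥ y = 0) {y : Fin N → ℝ} (hy : y ∈ Submodule.span ℝ s) : φ ⬝ᵥ y = 0 := by
  induction hy using Submodule.span_induction with
  | mem y hy => exact h y hy
  | zero => simp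
  | add y z _ _ hy hz => rw [dotProduct_add, hy, hz, add_zero]
  | smul c y _ hy => rw [dotProduct_smul, hy, smul_zero]

/-- `m` linear equations in `m + 1` real unknowns have a non-trivial solution. [folklore] -/
theorem exists_ne_zero_sum_mul_eq_zero {m : ℕ} (G : Fin (m + 1) → Fin m → ℝ) :
    ∃ α : Fin (m + 1) → ℝ, α ≠ 0 ∧ ∀ j, ∑ k, α k * G k j = 0 := by
  let T : (Fin (m + 1) → ℝ) →ₗ[ℝ] (Fin m → ℝ) :=
    { toFun := fun α j => ∑ k, α k * G k j
      map_add' := fun a b => by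
        funext j
        simp only [Pi.add_apply, add_mul, Finset.sum_add_distrib]
      map_smul' := fun c a => by
        funext j
        simp only [Pi.smul_apply, smul_eq_mul, RingHom.id_apply, Finset.mul_sum, mul_assoc] }
  have hker : LinearMap.ker T ≠ ⊥ := LinearMap.ker_ne_bot_of_finrank_lt (by simp)
  obtain ⟨α, hαT, hα0⟩ := Submodule.exists_mem_ne_zero_of_ne_bot hker
  exact ⟨α, hα0, fun j => congrFun (LinearMap.mem_ker.mp hαT) j⟩

/-- **Unitriangular systems span the same flags.** If `v_i - x_i ∈ span_ℤ(x_l : l < i)` for all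
`i`, then `x_i ∈ span_ℝ(v_l : l ≤ i)` for all `i`. [folklore] -/
theorem mem_span_of_unitriangular {m : ℕ} {V : Type*} [AddCommGroup V] [Module ℝ V]
    (x v : Fin m → V) (h : ∀ i, v i - x i ∈ Submodule.span ℤ (x '' {l | l < i})) :
    ∀ i, x i ∈ Submodule.span ℝ (v '' {l | l ≤ i}) := by
  suffices H : ∀ n : ℕ, ∀ i : Fin m, (i : ℕ) < n → x i ∈ Submodule.span ℝ (v '' {l | l ≤ i}) from
    fun i => H (i + 1) i (Nat.lt_succ_self _)
  intro n
  induction n with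
  | zero => intro i hi; exact absurd hi (Nat.not_lt_zero _)
  | succ n ih =>
    intro i hi
    have hvi : v i ∈ Submodule.span ℝ (v '' {l | l ≤ i}) :=
      Submodule.subset_span ⟨i, (le_refl i : i ∈ {l | l ≤ i}), rfl⟩
    have hsub : x '' {l | l < i} ⊆ (Submodule.span ℝ (v '' {l | l ≤ i}) : Set V) := by
      rintro _ ⟨l, hl, rfl⟩
      have hl' : (l : ℕ) < n := lt_of_lt_of_le (Fin.lt_def.mp hl) (by omega)
      refine Submodule.span_mono (Set.image_mono fun l' hl'' => ?_) (ih l hl')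
      exact le_trans (show l' ≤ l from hl'') (le_of_lt hl)
    have hdiff : v i - x i ∈ Submodule.span ℝ (v '' {l | l ≤ i}) := by
      have h1 : Submodule.span ℤ (x '' {l | l < i}) ≤
          (Submodule.span ℝ (x '' {l | l < i})).restrictScalars ℤ :=
        Submodule.span_le_restrictScalars ℤ ℝ _
      have h2 : Submodule.span ℝ (x '' {l | l < i}) ≤ Submodule.span ℝ (v '' {l | l ≤ i}) :=
        Submodule.span_le.mpr hsub
      exact h2 (h1 (h i))
    have : x i = v i - (v i - x i) := by abel
    rw [this]
    exact Submodule.sub_mem _ hvi hdiff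

/-- Consequence: `span_ℝ(x) ≤ span_ℝ(v)` for a unitriangular pair. [folklore] -/
theorem span_le_span_of_unitriangular {m : ℕ} {V : Type*} [AddCommGroup V] [Module ℝ V]
    (x v : Fin m → V) (h : ∀ i, v i - x i ∈ Submodule.span ℤ (x '' {l | l < i})) :
    Submodule.span ℝ (Set.range x) ≤ Submodule.span ℝ (Set.range v) := by
  rw [Submodule.span_le]
  rintro _ ⟨i, rfl⟩
  exact Submodule.span_mono (Set.image_subset_range _ _) (mem_span_of_unitriangular x v h i)

/-- Conversely `v_i ∈ span_ℤ(x_l : l ≤ i)` (hence `span(v) ≤ span(x)`) for a unitriangular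
pair. [folklore] -/
theorem mem_zspan_of_unitriangular {m : ℕ} {V : Type*} [AddCommGroup V] [Module ℝ V]
    (x v : Fin m → V) (h : ∀ i, v i - x i ∈ Submodule.span ℤ (x '' {l | l < i})) (i : Fin m) :
    v i ∈ Submodule.span ℤ (x '' {l | l ≤ i}) := by
  have : v i = x i + (v i - x i) := by abel
  rw [this]
  refine Submodule.add_mem _ (Submodule.subset_span ⟨i, (le_refl i : i ∈ {l | l ≤ i}), rfl⟩) ?_
  exact Submodule.span_mono (Set.image_mono fun l hl => le_of_lt (show l < i from hl)) (h i)

/-- `span_ℝ(v) ≤ span_ℝ(x)` for a unitriangular pair. [folklore] -/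
theorem span_le_span_of_unitriangular' {m : ℕ} {V : Type*} [AddCommGroup V] [Module ℝ V]
    (x v : Fin m → V) (h : ∀ i, v i - x i ∈ Submodule.span ℤ (x '' {l | l < i})) :
    Submodule.span ℝ (Set.range v) ≤ Submodule.span ℝ (Set.range x) := by
  rw [Submodule.span_le]
  rintro _ ⟨i, rfl⟩
  have h1 : Submodule.span ℤ (x '' {l | l ≤ i}) ≤
      (Submodule.span ℝ (x '' {l | l ≤ i})).restrictScalars ℤ :=
    Submodule.span_le_restrictScalars ℤ ℝ _
  exact Submodule.span_mono (Set.image_subset_range _ _) (h1 (mem_zspan_of_unitriangular x v h i))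

/-! ### The constant -/

/-- The constant `C(m)` of Evertse's lemma for `m` forms: `C(0) = 1`,
`C(m+1) = (m+1)(1 + m C(m))`. [cite: BombieriGubler2006, Lemma 7.5.29] -/
def evC : ℕ → ℝ
  | 0 => 1
  | m + 1 => (m + 1) * (1 + m * evC m)

/-- `evC (m+1) = (m+1)(1 + m evC m)`. [folklore] -/
theorem evC_succ (m : ℕ) : evC (m + 1) = (m + 1) * (1 + m * evC m) := rfl

/-- `1 ≤ evC m`. [folklore] -/
theorem one_le_evC : ∀ m : ℕ, 1 ≤ evC m
  | 0 => le_rfl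
  | m + 1 => by
    rw [evC_succ]
    have h1 := one_le_evC m
    have hm : (0 : ℝ) ≤ m := Nat.cast_nonneg m
    have hmC : 0 ≤ (m : ℝ) * evC m := mul_nonneg hm (zero_le_one.trans h1)
    nlinarith

/-- `evC m ≤ evC (m+1)`. [folklore] -/
theorem evC_le_succ (m : ℕ) : evC m ≤ evC (m + 1) := by
  rw [evC_succ]
  rcases Nat.eq_zero_or_pos m with rfl | hm1
  · simp [evC]
  · have h1 := one_le_evC m
    have hm : (1 : ℝ) ≤ m := by exact_mod_cast hm1
    have hmC : evC m ≤ (m : ℝ) * evC m := le_mul_of_one_le_left (zero_le_one.trans h1) hm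
    have hmmC : 0 ≤ (m : ℝ) * (m * evC m) := by positivity
    nlinarith

/-- `m evC m ≤ evC (m+1)`. [folklore] -/
theorem mul_evC_le_succ (m : ℕ) : m * evC m ≤ evC (m + 1) := by
  rw [evC_succ]
  have h1 := one_le_evC m
  have hm : (0 : ℝ) ≤ m := Nat.cast_nonneg m
  have hmC : 0 ≤ (m : ℝ) * evC m := mul_nonneg hm (zero_le_one.trans h1)
  have hmmC : 0 ≤ (m : ℝ) * (m * evC m) := by positivity
  nlinarith

/-- `m + 1 + m (m/2) evC m ≤ evC (m+1)`. [folklore] -/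
theorem bound_evC_le_succ (m : ℕ) : (m + 1) + m * (m / 2 * evC m) ≤ evC (m + 1) := by
  rw [evC_succ]
  have h1 := one_le_evC m
  have hm : (0 : ℝ) ≤ m := Nat.cast_nonneg m
  have hmC : 0 ≤ (m : ℝ) * evC m := mul_nonneg hm (zero_le_one.trans h1)
  have hmmC : 0 ≤ (m : ℝ) * (m * evC m) := by positivity
  nlinarith

/-! ### Evertse's lemma: the induction -/

/-- **Evertse's lemma, inductive form** (B–G Lemma 7.5.29 for `K = ℚ`, `v = ∞`, integer
coefficients): for `m` points `x_j ∈ ℝ^N` and `m` real forms `y ↦ f_k · y` which are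
independent on `span(x)` (no non-trivial `Σ r_k f_k` kills all `x_j`), and levels
`μ_0 ≤ ⋯ ≤ μ_{m-1}` with `|f_k · x_j| ≤ μ_j`, there are `v_j` with
`v_j - x_j ∈ span_ℤ(x_l : l < j)` and a permutation `π` with
`|f_{π i} · v_j| ≤ C(m) min(μ_i, μ_j)` for all `i, j`. [cite: BombieriGubler2006, Lemma 7.5.29] -/
theorem evertse_aux (m : ℕ) :
    ∀ (x : Fin m → Fin N → ℝ) (f : Fin m → Fin N → ℝ) (μ : Fin m → ℝ),
      Monotone μ → (∀ k j, |f k ⬝ᵥ x j| ≤ μ j) →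
      (∀ r : Fin m → ℝ, (∀ j, ∑ k, r k * (f k ⬝ᵥ x j) = 0) → r = 0) →
      ∃ (v : Fin m → Fin N → ℝ) (π : Equiv.Perm (Fin m)),
        (∀ i, v i - x i ∈ Submodule.span ℤ (x '' {l | l < i})) ∧
        ∀ i j, |f (π i) ⬝ᵥ v j| ≤ evC m * min (μ i) (μ j) := by
  induction m with
  | zero =>
    intro x f μ _ _ _
    exact ⟨x, Equiv.refl _, fun i => Fin.elim0 i, fun i => Fin.elim0 i⟩
  | succ m ih =>
    intro x f μ hμ hb hind
    /- Step 1: a non-trivial relation among the forms on `span(x_0, …, x_{m-1})` (7.38) -/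
    obtain ⟨α, hα0, hα⟩ :=
      exists_ne_zero_sum_mul_eq_zero (fun k (j : Fin m) => f k ⬝ᵥ x (Fin.castSucc j))
    obtain ⟨k₀, -, hk₀⟩ := Finset.exists_max_image Finset.univ (fun k => |α k|) Finset.univ_nonempty
    have hk₀' : ∀ k, |α k| ≤ |α k₀| := fun k => hk₀ k (Finset.mem_univ k)
    have hαk₀ : α k₀ ≠ 0 := by
      intro h0
      apply hα0
      funext k
      have := hk₀' k
      rw [h0, abs_zero] at this
      exact abs_eq_zero.mp (le_antisymm this (abs_nonneg _))
    set β : Fin (m + 1) → ℝ := fun k => -α k / α k₀ with hβ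
    have hβle : ∀ k, |β k| ≤ 1 := by
      intro k
      rw [hβ]
      simp only [abs_div, abs_neg]
      exact div_le_one_of_le₀ (hk₀' k) (abs_nonneg _)
    -- the relation `f_{k₀} · y = Σ_{i} β_{sa i} f_{sa i} · y` on `span(x ∘ castSucc)`
    set ψ : Fin N → ℝ := f k₀ - ∑ i : Fin m, β (k₀.succAbove i) • f (k₀.succAbove i) with hψ
    have hψx : ∀ j : Fin m, ψ ⬝ᵥ x (Fin.castSucc j) = 0 := by
      intro j
      have h := hα j
      rw [Fin.sum_univ_succAbove _ k₀] at h
      have key : α k₀ * (ψ ⬝ᵥ x (Fin.castSucc j)) =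
          α k₀ * (f k₀ ⬝ᵥ x (Fin.castSucc j)) +
            ∑ i : Fin m, α (k₀.succAbove i) * (f (k₀.succAbove i) ⬝ᵥ x (Fin.castSucc j)) := by
        rw [hψ, sub_dotProduct, sum_dotProduct]
        simp only [smul_dotProduct, smul_eq_mul, hβ]
        rw [mul_sub, Finset.mul_sum]
        have hi : ∀ i : Fin m, α k₀ * (-α (k₀.succAbove i) / α k₀ *
            (f (k₀.succAbove i) ⬝ᵥ x (Fin.castSucc j))) =
            -(α (k₀.succAbove i) * (f (k₀.succAbove i) ⬝ᵥ x (Fin.castSucc j))) := by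
          intro i
          field_simp
        simp only [hi, Finset.sum_neg_distrib]
        ring
      have h0 : α k₀ * (ψ ⬝ᵥ x (Fin.castSucc j)) = 0 := by rw [key]; exact h
      exact (mul_eq_zero.mp h0).resolve_left hαk₀
    have hψspan : ∀ y ∈ Submodule.span ℝ (Set.range (x ∘ Fin.castSucc)), ψ ⬝ᵥ y = 0 := by
      intro y hy
      refine dotProduct_eq_zero_of_mem_span ?_ hy
      rintro _ ⟨j, rfl⟩
      exact hψx j
    have hrel : ∀ y ∈ Submodule.span ℝ (Set.range (x ∘ Fin.castSucc)),
        f k₀ ⬝ᵥ y = ∑ i : Fin m, β (k₀.succAbove i) * (f (k₀.succAbove i) ⬝ᵥ y) := by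
      intro y hy
      have h := hψspan y hy
      rw [hψ, sub_dotProduct, sum_dotProduct, sub_eq_zero] at h
      simpa only [smul_dotProduct, smul_eq_mul] using h
    /- Step 2: the remaining forms stay independent on `span(x ∘ castSucc)` -/
    set x' : Fin m → Fin N → ℝ := x ∘ Fin.castSucc with hx'
    set f' : Fin m → Fin N → ℝ := f ∘ k₀.succAbove with hf'
    set μ' : Fin m → ℝ := μ ∘ Fin.castSucc with hμ'
    have hμ'mono : Monotone μ' := fun a b hab => hμ (by simpa using hab)
    have hb' : ∀ k j, |f' k ⬝ᵥ x' j| ≤ μ' j := fun k j => hb _ _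
    have hind' : ∀ r' : Fin m → ℝ, (∀ j, ∑ k, r' k * (f' k ⬝ᵥ x' j) = 0) → r' = 0 := by
      intro r' hr'
      -- `δ = b r̃ - a α` kills every `x_j`
      set a : ℝ := ∑ i : Fin m, r' i * (f (k₀.succAbove i) ⬝ᵥ x (Fin.last m)) with ha
      set b : ℝ := ∑ k, α k * (f k ⬝ᵥ x (Fin.last m)) with hb0
      set rt : Fin (m + 1) → ℝ := Fin.insertNth k₀ 0 r' with hrt
      have hrt0 : rt k₀ = 0 := by simp [hrt]
      have hrts : ∀ i, rt (k₀.succAbove i) = r' i := by simp [hrt]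
      have hrt_sum : ∀ g : Fin (m + 1) → ℝ, ∑ k, rt k * g k = ∑ i : Fin m, r' i * g (k₀.succAbove i) := by
        intro g
        rw [Fin.sum_univ_succAbove _ k₀, hrt0, zero_mul, zero_add]
        exact Finset.sum_congr rfl fun i _ => by rw [hrts]
      set δ : Fin (m + 1) → ℝ := fun k => b * rt k - a * α k with hδ
      have hδ0 : δ = 0 := by
        apply hind
        intro j
        simp only [hδ, sub_mul, Finset.sum_sub_distrib, mul_assoc, ← Finset.mul_sum]
        rw [hrt_sum]
        induction j using Fin.lastCases with
        | last =>
          rw [show (∑ i : Fin m, r' i * (f (k₀.succAbove i) ⬝ᵥ x (Fin.last m))) = a from rfl,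
            show (∑ k, α k * (f k ⬝ᵥ x (Fin.last m))) = b from rfl]
          ring
        | cast j =>
          have h1 : ∑ i : Fin m, r' i * (f (k₀.succAbove i) ⬝ᵥ x (Fin.castSucc j)) = 0 := hr' j
          have h2 : ∑ k, α k * (f k ⬝ᵥ x (Fin.castSucc j)) = 0 := hα j
          rw [h1, h2, mul_zero, mul_zero, sub_zero]
      have ha0 : a = 0 := by
        have := congrFun hδ0 k₀
        simp only [hδ, hrt0, mul_zero, zero_sub, Pi.zero_apply, neg_eq_zero, mul_eq_zero] at this
        exact this.resolve_right hαk₀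
      have hbne : b ≠ 0 := by
        intro hb00
        apply hα0
        apply hind
        intro j
        induction j using Fin.lastCases with
        | last => exact hb00
        | cast j => exact hα j
      funext i
      have := congrFun hδ0 (k₀.succAbove i)
      simp only [hδ, ha0, zero_mul, sub_zero, Pi.zero_apply, mul_eq_zero, hrts] at this
      exact this.resolve_left hbne
    /- Step 3: the induction hypothesis -/
    obtain ⟨v', π', hv'tri, hv'bd⟩ := ih x' f' μ' hμ'mono hb' hind'
    have hspan_v'_le : Submodule.span ℝ (Set.range v') ≤ Submodule.span ℝ (Set.range x') :=
      span_le_span_of_unitriangular' x' v' hv'tri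
    have hspan_x'_le : Submodule.span ℝ (Set.range x') ≤ Submodule.span ℝ (Set.range v') :=
      span_le_span_of_unitriangular x' v' hv'tri
    have hv'mem : ∀ j, v' j ∈ Submodule.span ℝ (Set.range x') :=
      fun j => hspan_v'_le (Submodule.subset_span ⟨j, rfl⟩)
    /- Step 4: the linear system (7.40) `H γ = t`, `H i j = f_{sa(π' i)} · v'_j` -/
    set H : Matrix (Fin m) (Fin m) ℝ := fun i j => f' (π' i) ⬝ᵥ v' j with hH
    have hHker : ∀ r : Fin m → ℝ, r ᵥ* H = 0 → r = 0 := by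
      intro r hr
      -- a row relation gives a functional `Σ r_i f_{sa(π' i)}` vanishing on `span(v') = span(x')`
      set φ : Fin N → ℝ := ∑ i, r i • f' (π' i) with hφ
      have hφv : ∀ j, φ ⬝ᵥ v' j = 0 := by
        intro j
        have := congrFun hr j
        simp only [vecMul, dotProduct, Pi.zero_apply] at this
        simp only [hH] at this
        rw [hφ, sum_dotProduct]
        simpa only [smul_dotProduct, smul_eq_mul] using this
      have hφx : ∀ j, φ ⬝ᵥ x' j = 0 := by
        intro j
        refine dotProduct_eq_zero_of_mem_span (s := Set.range v') ?_
          (hspan_x'_le (Submodule.subset_span ⟨j, rfl⟩))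
        rintro _ ⟨j', rfl⟩
        exact hφv j'
      -- reindex by `π'` and apply `hind'`
      have hr'' : (r ∘ π'.symm) = 0 := by
        apply hind'
        intro j
        have h := hφx j
        rw [hφ, sum_dotProduct] at h
        simp only [smul_dotProduct, smul_eq_mul] at h
        have hre : ∑ k, (r ∘ π'.symm) k * (f' k ⬝ᵥ x' j) = ∑ i, r i * (f' (π' i) ⬝ᵥ x' j) := by
          rw [← Equiv.sum_comp π']
          simp [Function.comp]
        rw [hre, h]
      funext i
      have := congrFun hr'' (π' i)
      simpa using this
    have hHinj : Function.Injective fun r : Fin m → ℝ => r ᵥ* H := by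
      intro r₁ r₂ h
      have h' : (r₁ - r₂) ᵥ* H = 0 := by
        rw [Matrix.sub_vecMul]
        exact sub_eq_zero.mpr h
      exact sub_eq_zero.mp (hHker _ h')
    have hHunit : IsUnit H := Matrix.vecMul_injective_iff_isUnit.mp hHinj
    obtain ⟨γ, hγ⟩ := Matrix.mulVec_surjective_iff_isUnit.mpr hHunit
      (fun i => f' (π' i) ⬝ᵥ x (Fin.last m))
    have hγ' : ∀ i, ∑ j, H i j * γ j = f' (π' i) ⬝ᵥ x (Fin.last m) := fun i => congrFun hγ i
    /- Step 5: the new point `v_last = x_last + Σ ξ_j v'_j`, `ξ_j = -round γ_j` -/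
    set ξ : Fin m → ℤ := fun j => -round (γ j) with hξ
    have hξγ : ∀ j, |γ j + (ξ j : ℝ)| ≤ 1 / 2 := by
      intro j
      rw [hξ]
      simp only [Int.cast_neg]
      rw [← sub_eq_add_neg]
      exact abs_sub_round (γ j)
    set vlast : Fin N → ℝ := x (Fin.last m) + ∑ j, (ξ j : ℝ) • v' j with hvlast
    set v : Fin (m + 1) → Fin N → ℝ := Fin.snoc v' vlast with hv
    have hvcs : ∀ j : Fin m, v (Fin.castSucc j) = v' j := fun j => by simp [hv]
    have hvl : v (Fin.last m) = vlast := by simp [hv]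
    /- Step 6: the permutation `π` -/
    let g : Fin (m + 1) → Fin (m + 1) := Fin.snoc (fun i => k₀.succAbove (π' i)) k₀
    have hgcs : ∀ i : Fin m, g (Fin.castSucc i) = k₀.succAbove (π' i) := fun i => by simp [g]
    have hgl : g (Fin.last m) = k₀ := by simp [g]
    have hginj : Function.Injective g := by
      intro a b hab
      induction a using Fin.lastCases with
      | last =>
        induction b using Fin.lastCases with
        | last => rfl
        | cast b => rw [hgl, hgcs] at hab; exact absurd hab.symm (Fin.succAbove_ne _ _)
      | cast a =>
        induction b using Fin.lastCases with
        | last => rw [hgl, hgcs] at hab; exact absurd hab (Fin.succAbove_ne _ _)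
        | cast b =>
          rw [hgcs, hgcs] at hab
          have := π'.injective (Fin.succAbove_right_injective hab)
          rw [this]
    let π : Equiv.Perm (Fin (m + 1)) := Equiv.ofBijective g (Finite.injective_iff_bijective.mp hginj)
    have hπcs : ∀ i : Fin m, π (Fin.castSucc i) = k₀.succAbove (π' i) := hgcs
    have hπl : π (Fin.last m) = k₀ := hgl
    /- Step 7: bounds -/
    have hCm := one_le_evC m
    have hμcs_le : ∀ i : Fin m, μ (Fin.castSucc i) ≤ μ (Fin.last m) :=
      fun i => hμ (Fin.castSucc_lt_last i).le
    -- (7.39): the inherited bounds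
    have hb_cc : ∀ i j : Fin m, |f (k₀.succAbove (π' i)) ⬝ᵥ v' j| ≤
        evC m * min (μ (Fin.castSucc i)) (μ (Fin.castSucc j)) := fun i j => hv'bd i j
    -- `i = last`, `j < m`: by the relation (7.38) on `span(x')`
    have hb_lc : ∀ j : Fin m, |f k₀ ⬝ᵥ v' j| ≤ m * evC m * μ (Fin.castSucc j) := by
      intro j
      rw [hrel (v' j) (hv'mem j)]
      refine (Finset.abs_sum_le_sum_abs _ _).trans ?_
      have hterm : ∀ i : Fin m, |β (k₀.succAbove i) * (f (k₀.succAbove i) ⬝ᵥ v' j)| ≤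
          |f (k₀.succAbove i) ⬝ᵥ v' j| := by
        intro i
        rw [abs_mul]
        exact mul_le_of_le_one_left (abs_nonneg _) (hβle _)
      refine (Finset.sum_le_sum fun i _ => hterm i).trans ?_
      -- reindex by `π'`
      rw [← Equiv.sum_comp π' (fun i => |f (k₀.succAbove i) ⬝ᵥ v' j|)]
      calc ∑ i, |f (k₀.succAbove (π' i)) ⬝ᵥ v' j|
          ≤ ∑ _i : Fin m, evC m * μ (Fin.castSucc j) := Finset.sum_le_sum fun i _ =>
            (hb_cc i j).trans (mul_le_mul_of_nonneg_left (min_le_right _ _) (by linarith))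
        _ = m * evC m * μ (Fin.castSucc j) := by
            rw [Finset.sum_const, Finset.card_univ, Fintype.card_fin, nsmul_eq_mul]; ring
    -- `i < m`, `j = last`: by the rounding (7.40)
    have hb_cl : ∀ i : Fin m, |f (k₀.succAbove (π' i)) ⬝ᵥ vlast| ≤
        m / 2 * evC m * μ (Fin.castSucc i) := by
      intro i
      have hexp : f (k₀.succAbove (π' i)) ⬝ᵥ vlast = ∑ j, (γ j + ξ j) * H i j := by
        rw [hvlast, dotProduct_add, dotProduct_sum]
        simp only [dotProduct_smul, smul_eq_mul]
        rw [show f (k₀.succAbove (π' i)) ⬝ᵥ x (Fin.last m) = f' (π' i) ⬝ᵥ x (Fin.last m) from rfl,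
          ← hγ' i, ← Finset.sum_add_distrib]
        refine Finset.sum_congr rfl fun j _ => ?_
        rw [show f (k₀.succAbove (π' i)) ⬝ᵥ v' j = H i j from rfl]
        ring
      rw [hexp]
      refine (Finset.abs_sum_le_sum_abs _ _).trans ?_
      calc ∑ j, |(γ j + ξ j) * H i j|
          ≤ ∑ _j : Fin m, 1 / 2 * (evC m * μ (Fin.castSucc i)) := by
            refine Finset.sum_le_sum fun j _ => ?_
            rw [abs_mul]
            refine mul_le_mul (hξγ j) ?_ (abs_nonneg _) (by norm_num)
            exact (hb_cc i j).trans (mul_le_mul_of_nonneg_left (min_le_left _ _) (by linarith))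
        _ = m / 2 * evC m * μ (Fin.castSucc i) := by
            rw [Finset.sum_const, Finset.card_univ, Fintype.card_fin, nsmul_eq_mul]; ring
    -- `i = j = last`
    have hb_ll : |f k₀ ⬝ᵥ vlast| ≤ ((m + 1) + m * (m / 2 * evC m)) * μ (Fin.last m) := by
      -- `ψ(vlast) = ψ(x_last)` since `vlast - x_last ∈ span(v') = span(x')`
      have hdiff : vlast - x (Fin.last m) ∈ Submodule.span ℝ (Set.range x') := by
        rw [hvlast, add_sub_cancel_left]
        exact Submodule.sum_mem _ fun j _ => Submodule.smul_mem _ _ (hv'mem j)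
      have hψv : ψ ⬝ᵥ vlast = ψ ⬝ᵥ x (Fin.last m) := by
        have := hψspan _ hdiff
        rwa [dotProduct_sub, sub_eq_zero] at this
      have hdecomp : f k₀ ⬝ᵥ vlast =
          ψ ⬝ᵥ x (Fin.last m) + ∑ i : Fin m, β (k₀.succAbove i) * (f (k₀.succAbove i) ⬝ᵥ vlast) := by
        rw [← hψv, hψ, sub_dotProduct, sum_dotProduct]
        simp only [smul_dotProduct, smul_eq_mul]
        ring
      have hψx_bd : |ψ ⬝ᵥ x (Fin.last m)| ≤ (m + 1) * μ (Fin.last m) := by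
        rw [hψ, sub_dotProduct, sum_dotProduct]
        simp only [smul_dotProduct, smul_eq_mul]
        refine (abs_sub _ _).trans ?_
        have h1 : |f k₀ ⬝ᵥ x (Fin.last m)| ≤ μ (Fin.last m) := hb _ _
        have h2 : |∑ i : Fin m, β (k₀.succAbove i) * (f (k₀.succAbove i) ⬝ᵥ x (Fin.last m))| ≤
            m * μ (Fin.last m) := by
          refine (Finset.abs_sum_le_sum_abs _ _).trans ?_
          calc ∑ i : Fin m, |β (k₀.succAbove i) * (f (k₀.succAbove i) ⬝ᵥ x (Fin.last m))|
              ≤ ∑ _i : Fin m, μ (Fin.last m) := Finset.sum_le_sum fun i _ => by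
                rw [abs_mul]
                exact (mul_le_of_le_one_left (abs_nonneg _) (hβle _)).trans (hb _ _)
            _ = m * μ (Fin.last m) := by
                rw [Finset.sum_const, Finset.card_univ, Fintype.card_fin, nsmul_eq_mul]
        linarith
      have hsum_bd : |∑ i : Fin m, β (k₀.succAbove i) * (f (k₀.succAbove i) ⬝ᵥ vlast)| ≤
          m * (m / 2 * evC m) * μ (Fin.last m) := by
        refine (Finset.abs_sum_le_sum_abs _ _).trans ?_
        have hterm : ∀ i : Fin m, |β (k₀.succAbove i) * (f (k₀.succAbove i) ⬝ᵥ vlast)| ≤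
            |f (k₀.succAbove i) ⬝ᵥ vlast| := fun i => by
          rw [abs_mul]; exact mul_le_of_le_one_left (abs_nonneg _) (hβle _)
        refine (Finset.sum_le_sum fun i _ => hterm i).trans ?_
        rw [← Equiv.sum_comp π' (fun i => |f (k₀.succAbove i) ⬝ᵥ vlast|)]
        calc ∑ i, |f (k₀.succAbove (π' i)) ⬝ᵥ vlast|
            ≤ ∑ _i : Fin m, m / 2 * evC m * μ (Fin.last m) := Finset.sum_le_sum fun i _ =>
              (hb_cl i).trans (mul_le_mul_of_nonneg_left (hμcs_le i) (by positivity))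
          _ = m * (m / 2 * evC m) * μ (Fin.last m) := by
              rw [Finset.sum_const, Finset.card_univ, Fintype.card_fin, nsmul_eq_mul]; ring
      rw [hdecomp]
      refine (abs_add_le _ _).trans ?_
      linarith
    /- Step 8: assemble -/
    refine ⟨v, π, ?_, ?_⟩
    · -- unitriangularity
      intro i
      induction i using Fin.lastCases with
      | last =>
        rw [hvl, hvlast, add_sub_cancel_left]
        refine Submodule.sum_mem _ fun j _ => ?_
        rw [Int.cast_smul_eq_zsmul]
        refine Submodule.smul_mem _ _ ?_
        have hj := mem_zspan_of_unitriangular x' v' hv'tri j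
        refine Submodule.span_mono ?_ hj
        rintro _ ⟨l, _, rfl⟩
        exact ⟨Fin.castSucc l, Fin.castSucc_lt_last l, rfl⟩
      | cast i =>
        rw [hvcs]
        have hi := hv'tri i
        refine Submodule.span_mono ?_ hi
        rintro _ ⟨l, hl, rfl⟩
        exact ⟨Fin.castSucc l, by simpa using hl, rfl⟩
    · -- the bounds
      have hμmono_min : ∀ i : Fin m, min (μ (Fin.last m)) (μ (Fin.castSucc i)) = μ (Fin.castSucc i) :=
        fun i => min_eq_right (hμcs_le i)
      intro i j
      induction i using Fin.lastCases with
      | last =>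
        rw [hπl]
        induction j using Fin.lastCases with
        | last =>
          rw [hvl, min_self]
          exact hb_ll.trans (mul_le_mul_of_nonneg_right (bound_evC_le_succ m)
            ((abs_nonneg _).trans (hb k₀ (Fin.last m))))
        | cast j =>
          rw [hvcs, hμmono_min]
          refine (hb_lc j).trans (mul_le_mul_of_nonneg_right (mul_evC_le_succ m) ?_)
          exact (abs_nonneg _).trans (hb k₀ _)
      | cast i =>
        rw [hπcs]
        induction j using Fin.lastCases with
        | last =>
          rw [hvl, min_comm, hμmono_min]
          refine (hb_cl i).trans (mul_le_mul_of_nonneg_right ?_ ((abs_nonneg _).trans (hb k₀ _)))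
          have := mul_evC_le_succ m
          have hm : (0 : ℝ) ≤ m := Nat.cast_nonneg m
          nlinarith
        | cast j =>
          rw [hvcs]
          exact (hb_cc i j).trans (mul_le_mul_of_nonneg_right (evC_le_succ m)
            (le_min ((abs_nonneg _).trans (hb k₀ _)) ((abs_nonneg _).trans (hb k₀ _))))

/-- A unitriangular modification of an independent family is independent. [folklore] -/
theorem linearIndependent_of_unitriangular {m : ℕ} {V : Type*} [AddCommGroup V] [Module ℝ V]
    (x v : Fin m → V) (hx : LinearIndependent ℝ x)
    (h : ∀ i, v i - x i ∈ Submodule.span ℤ (x '' {l | l < i})) : LinearIndependent ℝ v := by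
  have hspan : Submodule.span ℝ (Set.range v) = Submodule.span ℝ (Set.range x) :=
    le_antisymm (span_le_span_of_unitriangular' x v h) (span_le_span_of_unitriangular x v h)
  rw [linearIndependent_iff_card_eq_finrank_span, Set.finrank, hspan, ← Set.finrank,
    ← linearIndependent_iff_card_eq_finrank_span.mp hx]

/-- **Evertse's lemma** (B–G Lemma 7.5.29) **for `K = ℚ` at the archimedean place, with integer
coefficients.** Let `A` be a real `N × N` matrix with `det A ≠ 0` (its rows are the forms
`L_0, …, L_{N-1}`), `x_0, …, x_{N-1}` a basis of `ℝ^N` and `μ_0 ≤ ⋯ ≤ μ_{N-1}` with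
`|(A x_j)_k| ≤ μ_j` for all `k, j`. Then there are `v_i = x_i + Σ_{l<i} ξ_{il} x_l` with
`ξ_{il} ∈ ℤ` (so `v_i - x_i ∈ span_ℤ(x_l : l < i)`; the `v_i` are again a basis) and a
permutation `π` with `|(A v_j)_{π(i)}| ≤ C min(μ_i, μ_j)` for all `i, j`, `C = evC N`.
[cite: BombieriGubler2006, Lemma 7.5.29] -/
theorem evertse (A : Matrix (Fin N) (Fin N) ℝ) (hA : A.det ≠ 0) (x : Fin N → Fin N → ℝ)
    (hx : LinearIndependent ℝ x) (μ : Fin N → ℝ) (hμ : Monotone μ)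
    (hb : ∀ k j, |(A *ᵥ x j) k| ≤ μ j) :
    ∃ (v : Fin N → Fin N → ℝ) (π : Equiv.Perm (Fin N)),
      (∀ i, v i - x i ∈ Submodule.span ℤ (x '' {l | l < i})) ∧
      LinearIndependent ℝ v ∧
      ∀ i j, |(A *ᵥ v j) (π i)| ≤ evC N * min (μ i) (μ j) := by
  have hAunit : IsUnit A := (Matrix.isUnit_iff_isUnit_det _).mpr hA.isUnit
  -- the forms (rows of `A`) are independent on `span(x) = ℝ^N`
  have hind : ∀ r : Fin N → ℝ, (∀ j, ∑ k, r k * (A k ⬝ᵥ x j) = 0) → r = 0 := by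
    intro r hr
    have hr' : ∀ j, (r ᵥ* A) ⬝ᵥ x j = 0 := by
      intro j
      rw [← dotProduct_mulVec]
      simpa [dotProduct, mulVec] using hr j
    have htop : Submodule.span ℝ (Set.range x) = ⊤ := hx.span_eq_top_of_card_eq_finrank' (by simp)
    have hall : ∀ y, (r ᵥ* A) ⬝ᵥ y = 0 := by
      intro y
      refine dotProduct_eq_zero_of_mem_span (s := Set.range x) ?_ (by rw [htop]; trivial)
      rintro _ ⟨j, rfl⟩
      exact hr' j
    have h0 : r ᵥ* A = 0 := dotProduct_self_eq_zero.mp (hall _)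
    exact Matrix.vecMul_injective_iff_isUnit.mpr hAunit (by simp only [h0, Matrix.zero_vecMul])
  obtain ⟨v, π, htri, hbd⟩ := evertse_aux N x (fun k => A k) μ hμ (fun k j => hb k j) hind
  exact ⟨v, π, htri, linearIndependent_of_unitriangular x v hx htri, fun i j => hbd i j⟩

end Literature.NumberTheory.DiophantineApproximation.Subspace
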